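/-
Origin: expansion seat `planner-pub-hodgecm-mc-theta-3-g10-0`, handover (E1) 2026-08-20T01:10Z md5 02321f8af1f9378936fefec1a19f2e14 (326 l.; NEW additive leaf; row-5 `A`-slot line inputs `archLineInputOf` over the datum `ArchLineDatum`; install AFTER period-1 #1101 ArchSideOf fb24bcdfe0c1, not without it) (`HOME/mc/pub-hodgecm-mc-theta-3-g10/lean/stage/HodgeCM/Model/ArchLineInputOf.lean`, md5 02321f8af1f9, 326 lines);
landed by the second packager (p2) in gate run 38 as `HodgeCM/Model/ArchLineInputOf.lean` (verbatim).
-/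
/-
HodgeCM/Model/ArchLineInputOf.lean — theta-3 lane (origin theta-3-g10, 2026-08-19; BINDER-OWNERS §1c row 5 `S`, the binder `A` of
period-1's `archSideOf … (A : ∀ k : Fin 4, ArchLineInput V (lineRepD V c.D hGR hGR₀ hGR₁ hGR₂ hGR₃ η k))`, `HodgeCM/Model/ArchSideOf.lean` §A/§E).
RUN 39+ DRAFT (compiled in theta-3-g10's private world `work/w38` against period-1's `ArchSideOf.lean` r3c b2c31453cb04 and PRIVATE
sketch-world twins of six tree files + `…SeesawCMLinesCollapse` (p194071); the kit row needs glue-2's K-1 twins of those, RUN 39).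

WHAT THIS FILE DOES.  It CONSTRUCTS the four `ArchLineInput` records from an `ArchLineDatum` — the archimedean test functions
`Φ_∞,k`, base points `x₀,k`, the integer weight vectors `μ k : InfinitePlace L → ℤ` ((J-μ); the weight field is LITERALLY
`w := archWeight L (μ k)`, binder-1's (N1): `hAw` is `rfl`, see `archLineInputOf_w`), the centre eigenvalues `c k`, and TWO NAMED
HYPOTHESES per line — and PROVES the weight identity (W-wt) = D5 of `ArchLineInput` from them:

* PROVED here (kernel, no cited input): at `g = 1` the S-side line representation of line `k` COLLAPSES (tree (J-a),
  `cmLineRepFin₀/₁_apply_eq_smul_cmPairRep`, `cmConjLineRepFin₀/₁_apply_eq_smul_cmPairRep`, Howe1979 §3 / GelbartRogawski1991 §3.1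
  Remark p. 457) to `(η_k(1,u) · χ_k(1, u·1_{W_k})) • ω_k(1, u·1_{W_k})`, and by the CENTRE SWAP (`cmPairRep_center`: the pair splitting is
  trivial on the anti-diagonal centre) `ω_k(1, u·1_{W_k}) = ω_k(u·1_V, 1)`: the torus `U(W_k)(𝔸) = U(1)` acts on line `k` through the CENTRE
  of `U(V)(𝔸)` — `lineRepOf_one_apply_center k`.  Hence (W-wt) for line `k` ⟸ (D5-ctr)_k ∧ (J-μ)_k, `lineRepD_one_inf_testFun`.
* HYPOTHESIS (D5-ctr)_k `hctr` : the archimedean centre `u_∞ · 1_V ∈ U(V)(ℝ)` acts on every `φ_N(Φ_∞,k)` by the scalar `c k u_∞` under the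
  small pair's Weil representation `cmPairRep e₁ hGR_k` — the `K_∞`-TYPE OF THE PINNED VECTOR restricted to the centre of `K_∞`
  (Kashiwara–Vergne 1978 / Howe: harmonics; binder-2's (J-μ) ArchDatum rows; see theta-3 ARCHLINE-SPEC.md §2″ «REDUCED OBLIGATION»).
* HYPOTHESIS (J-μ)_k `hμ` : the exponent identity `η_k(1,u_∞) · χ_k(1,u_∞·1) · c k u_∞ = archWeight L (μ k) u_∞` (characters of
  `U(1)(L⁺ ⊗ ℝ)` agree iff their ∞-types do; model1 2026-08-19: exponent identities stay explicit hypotheses, discharged by binder-2's rows).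
Constraints recorded, not yet consumed here: (K34-w) (binder-1 l.11757) on `μ 2, μ 3` vs `allowedChars (d34Of μ c)`; (K01-w) from the W pin's
`K_∞`-type `cmKTypeTwist … archKappa` + `archKappa_cmArchCenterIsotropy = 1` (tree p195299) on `μ 0 + μ 1`.

Nothing is cited and nothing is minted: definitions and kernel lemmas over LAYER B (`ArchSideTerm`), `ArchSideOf` §A/§D and the tree.
-/
import Summits.HodgeConjecture.HodgeCM.Model.ArchSideOf_2
import Literature.NumberTheory.GelbartRogawski1991.UnitaryDualPairThetaKernelCMKType
import Literature.NumberTheory.GelbartRogawski1991.UnitaryDualPairSeesawCMLinesCollapse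
import Literature.NumberTheory.Automorphic.UnitaryGroupAdelicCenter
import Literature.NumberTheory.Automorphic.UnitaryGroupAdelicOneTorus
import Literature.NumberTheory.Automorphic.UnitaryLineCharacters

set_option autoImplicit false

noncomputable section

open scoped Matrix SchwartzMap Classical
open NumberField NumberField.mixedEmbedding
open Literature.NumberTheory.Automorphic Literature.NumberTheory.Weil1964
open Literature.NumberTheory.GelbartRogawski1991.UnitaryDualPair
open HodgeCM.Adelic HodgeCM.PerL34

namespace HodgeCM.Model

namespace ArchSideTerm

variable {L : CMField} {ι₁ : L →+* ℂ} (V : HermSpace3 L ι₁) (S : StubTree.SeesawDatum L)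

/-! ## §1 Collapse of the four line representations at `g = 1`, centre form -/

section Collapse

variable
  (hGR : (cmSplittingDatum (L : Type) finProdFinEquiv (frameD V) (frameD_real V) (frameD_ne V) (dW S) (dW_real S) (dW_ne S)).CompatibleSplitting)
  (hGR₀ : (cmSplittingDatum (L : Type) (e₁) (frameD V) (frameD_real V) (frameD_ne V) (lineVec (L : Type) (dW S 0))
    (fun _ => dW_real S 0) (fun _ => dW_ne S 0)).CompatibleSplitting)
  (hGR₁ : (cmSplittingDatum (L : Type) (e₁) (frameD V) (frameD_real V) (frameD_ne V) (lineVec (L : Type) (dW S 1))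
    (fun _ => dW_real S 1) (fun _ => dW_ne S 1)).CompatibleSplitting)
  (hGR₂ : (cmSplittingDatum (L : Type) (e₁) (frameD V) (frameD_real V) (frameD_ne V) (lineVec (L : Type) (dW' S 0))
    (fun _ => dW'_real S 0) (fun _ => dW'_ne S 0)).CompatibleSplitting)
  (hGR₃ : (cmSplittingDatum (L : Type) (e₁) (frameD V) (frameD_real V) (frameD_ne V) (lineVec (L : Type) (dW' S 1))
    (fun _ => dW'_real S 1) (fun _ => dW'_ne S 1)).CompatibleSplitting)
  (η₀ η₁ η₂ η₃ : CMAdelic (L : Type) (frameD V) × CMAdelicOne (L : Type) →* ℂˣ)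

/-- the W pin's frame isomorphism sends `1 ∈ ↥(regimeSubgroup L V.Hm)` to `1`. -/
theorem cmFrameEquiv_regime_one :
    (cmFrameEquiv (L : Type) (frameG V) V.Hm (frameD V) (frame_congr V))
        ((1 : ↥(regimeSubgroup L V.Hm)) : ↥(HodgeCM.Adelic.adelicUnitaryGroup (L : Type) V.Hm)) = 1 :=
  map_one _

/-- **centre swap** for a CM dual pair `(U(diag dV), U(diag dW))`: `ω(1, u · 1_W) Φ = ω(u · 1_V, 1) Φ`
(tree `cmPairRep_center`: the pair representation is trivial on `(u·1_V, u⁻¹·1_W)`). -/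
theorem cmPairRep_one_center' {N M n : ℕ} (e : Fin N × Fin M ≃ Fin n)
    (dV : Fin N → (L : Type)) (hdV : ∀ i, IsCMField.complexConj L (dV i) = dV i) (hdV0 : ∀ i, dV i ≠ 0)
    (dW : Fin M → (L : Type)) (hdW : ∀ i, IsCMField.complexConj L (dW i) = dW i) (hdW0 : ∀ i, dW i ≠ 0)
    (hGR' : (cmSplittingDatum (L : Type) e dV hdV hdV0 dW hdW hdW0).CompatibleSplitting)
    (u : CMAdelicOne (L : Type)) (Φ : CMSchwartz (L : Type) n) :
    cmPairRep (L : Type) e dV hdV hdV0 dW hdW hdW0 hGR' (1, CMCenter (L : Type) dW u) Φ =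
      cmPairRep (L : Type) e dV hdV hdV0 dW hdW hdW0 hGR' (CMCenter (L : Type) dV u, 1) Φ := by
  have h := cmPairRep_center (L : Type) e dV hdV hdV0 dW hdW hdW0 hGR' u⁻¹ Φ
  rw [inv_inv] at h
  have hmul : ((1 : CMAdelic (L : Type) dV), CMCenter (L : Type) dW u) =
      (CMCenter (L : Type) dV u, (1 : CMAdelic (L : Type) dW)) * (CMCenter (L : Type) dV u⁻¹, CMCenter (L : Type) dW u) := by
    rw [Prod.mk_mul_mk, one_mul, map_inv, mul_inv_cancel]
  rw [hmul, map_mul, Module.End.mul_apply, h]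

/-- **line 0 at `g = 1`, centre form**: `lineRepOf 0 (1, t) φ = (η₀(1,u) · χ₀(1, u·1)) • cmPairRep e₁ hGR₀ (u · 1_V, 1) φ`, `u = t♭`. -/
theorem lineRepOf_zero_one_center (t : ↥(NumberField.relNormOneIdeles (↥(maximalRealSubfield L)) L))
    (φ : piSchwartzBruhat (↥(maximalRealSubfield L)) (Fin 3)) :
    lineRepOf V S hGR hGR₀ hGR₁ hGR₂ hGR₃ η₀ η₁ η₂ η₃ 0 (1, t) φ =
      ((η₀ (1, (UnitaryGroup.cmAdelicOneEquivRelNormOne (L : Type)).symm t) *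
            cmLineChar₀ (L : Type) finProdFinEquiv e₁ (frameD V) (frameD_real V) (frameD_ne V) (dW S) (dW_real S) (dW_ne S)
              hGR hGR₀ hGR₁
              (1, CMCenter (L : Type) (lineVec (L : Type) (dW S 0)) ((UnitaryGroup.cmAdelicOneEquivRelNormOne (L : Type)).symm t)) : ℂˣ) : ℂ) •
        cmPairRep (L : Type) e₁ (frameD V) (frameD_real V) (frameD_ne V) (lineVec (L : Type) (dW S 0)) (fun _ => dW_real S 0)
          (fun _ => dW_ne S 0) hGR₀
          (CMCenter (L : Type) (frameD V) ((UnitaryGroup.cmAdelicOneEquivRelNormOne (L : Type)).symm t), 1) φ := by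
  have h := cmLineRepFin₀_apply_eq_smul_cmPairRep (L : Type) finProdFinEquiv e₁ (frameD V) (frameD_real V) (frameD_ne V)
    (dW S) (dW_real S) (dW_ne S) hGR hGR₀ hGR₁ η₀ 1 t φ
  rw [cmPairRep_one_center'] at h
  show lineRep V S hGR hGR₀ hGR₁ hGR₂ hGR₃ η₀ η₁ η₂ η₃ 0
      ((cmFrameEquiv (L : Type) (frameG V) V.Hm (frameD V) (frame_congr V))
          ((1 : ↥(regimeSubgroup L V.Hm)) : ↥(HodgeCM.Adelic.adelicUnitaryGroup (L : Type) V.Hm)), t) φ = _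
  rw [cmFrameEquiv_regime_one]
  exact h

/-- **line 1 at `g = 1`, centre form**. -/
theorem lineRepOf_one_one_center (t : ↥(NumberField.relNormOneIdeles (↥(maximalRealSubfield L)) L))
    (φ : piSchwartzBruhat (↥(maximalRealSubfield L)) (Fin 3)) :
    lineRepOf V S hGR hGR₀ hGR₁ hGR₂ hGR₃ η₀ η₁ η₂ η₃ 1 (1, t) φ =
      ((η₁ (1, (UnitaryGroup.cmAdelicOneEquivRelNormOne (L : Type)).symm t) *
            cmLineChar₁ (L : Type) finProdFinEquiv e₁ (frameD V) (frameD_real V) (frameD_ne V) (dW S) (dW_real S) (dW_ne S)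
              hGR hGR₀ hGR₁
              (1, CMCenter (L : Type) (lineVec (L : Type) (dW S 1)) ((UnitaryGroup.cmAdelicOneEquivRelNormOne (L : Type)).symm t)) : ℂˣ) : ℂ) •
        cmPairRep (L : Type) e₁ (frameD V) (frameD_real V) (frameD_ne V) (lineVec (L : Type) (dW S 1)) (fun _ => dW_real S 1)
          (fun _ => dW_ne S 1) hGR₁
          (CMCenter (L : Type) (frameD V) ((UnitaryGroup.cmAdelicOneEquivRelNormOne (L : Type)).symm t), 1) φ := by
  have h := cmLineRepFin₁_apply_eq_smul_cmPairRep (L : Type) finProdFinEquiv e₁ (frameD V) (frameD_real V) (frameD_ne V)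
    (dW S) (dW_real S) (dW_ne S) hGR hGR₀ hGR₁ η₁ 1 t φ
  rw [cmPairRep_one_center'] at h
  show lineRep V S hGR hGR₀ hGR₁ hGR₂ hGR₃ η₀ η₁ η₂ η₃ 1
      ((cmFrameEquiv (L : Type) (frameG V) V.Hm (frameD V) (frame_congr V))
          ((1 : ↥(regimeSubgroup L V.Hm)) : ↥(HodgeCM.Adelic.adelicUnitaryGroup (L : Type) V.Hm)), t) φ = _
  rw [cmFrameEquiv_regime_one]
  exact h

/-- **line 2 at `g = 1`, centre form** (conjugated plane `isoGL·diag(a₂,a₃)·isoGL⁻¹`, tree `cmConjLineRepFin₀_apply_eq_smul_cmPairRep`). -/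
theorem lineRepOf_two_one_center (t : ↥(NumberField.relNormOneIdeles (↥(maximalRealSubfield L)) L))
    (φ : piSchwartzBruhat (↥(maximalRealSubfield L)) (Fin 3)) :
    lineRepOf V S hGR hGR₀ hGR₁ hGR₂ hGR₃ η₀ η₁ η₂ η₃ 2 (1, t) φ =
      ((η₂ (1, (UnitaryGroup.cmAdelicOneEquivRelNormOne (L : Type)).symm t) *
            cmConjLineChar₀ (L : Type) finProdFinEquiv e₁ (frameD V) (frameD_real V) (frameD_ne V) (dW S) (dW_real S) (dW_ne S)
              (dW' S) (dW'_real S) (dW'_ne S) S.isoGL (isoGL_hg₀ S) hGR hGR₂ hGR₃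
              (1, CMCenter (L : Type) (lineVec (L : Type) (dW' S 0)) ((UnitaryGroup.cmAdelicOneEquivRelNormOne (L : Type)).symm t)) : ℂˣ) : ℂ) •
        cmPairRep (L : Type) e₁ (frameD V) (frameD_real V) (frameD_ne V) (lineVec (L : Type) (dW' S 0)) (fun _ => dW'_real S 0)
          (fun _ => dW'_ne S 0) hGR₂
          (CMCenter (L : Type) (frameD V) ((UnitaryGroup.cmAdelicOneEquivRelNormOne (L : Type)).symm t), 1) φ := by
  have h := cmConjLineRepFin₀_apply_eq_smul_cmPairRep (L : Type) finProdFinEquiv e₁ (frameD V) (frameD_real V) (frameD_ne V)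
    (dW S) (dW_real S) (dW_ne S) (dW' S) (dW'_real S) (dW'_ne S) S.isoGL (isoGL_hg₀ S) hGR hGR₂ hGR₃ η₂ 1 t φ
  rw [cmPairRep_one_center'] at h
  show lineRep V S hGR hGR₀ hGR₁ hGR₂ hGR₃ η₀ η₁ η₂ η₃ 2
      ((cmFrameEquiv (L : Type) (frameG V) V.Hm (frameD V) (frame_congr V))
          ((1 : ↥(regimeSubgroup L V.Hm)) : ↥(HodgeCM.Adelic.adelicUnitaryGroup (L : Type) V.Hm)), t) φ = _
  rw [cmFrameEquiv_regime_one]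
  exact h

/-- **line 3 at `g = 1`, centre form** (tree `cmConjLineRepFin₁_apply_eq_smul_cmPairRep`). -/
theorem lineRepOf_three_one_center (t : ↥(NumberField.relNormOneIdeles (↥(maximalRealSubfield L)) L))
    (φ : piSchwartzBruhat (↥(maximalRealSubfield L)) (Fin 3)) :
    lineRepOf V S hGR hGR₀ hGR₁ hGR₂ hGR₃ η₀ η₁ η₂ η₃ 3 (1, t) φ =
      ((η₃ (1, (UnitaryGroup.cmAdelicOneEquivRelNormOne (L : Type)).symm t) *
            cmConjLineChar₁ (L : Type) finProdFinEquiv e₁ (frameD V) (frameD_real V) (frameD_ne V) (dW S) (dW_real S) (dW_ne S)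
              (dW' S) (dW'_real S) (dW'_ne S) S.isoGL (isoGL_hg₀ S) hGR hGR₂ hGR₃
              (1, CMCenter (L : Type) (lineVec (L : Type) (dW' S 1)) ((UnitaryGroup.cmAdelicOneEquivRelNormOne (L : Type)).symm t)) : ℂˣ) : ℂ) •
        cmPairRep (L : Type) e₁ (frameD V) (frameD_real V) (frameD_ne V) (lineVec (L : Type) (dW' S 1)) (fun _ => dW'_real S 1)
          (fun _ => dW'_ne S 1) hGR₃
          (CMCenter (L : Type) (frameD V) ((UnitaryGroup.cmAdelicOneEquivRelNormOne (L : Type)).symm t), 1) φ := by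
  have h := cmConjLineRepFin₁_apply_eq_smul_cmPairRep (L : Type) finProdFinEquiv e₁ (frameD V) (frameD_real V) (frameD_ne V)
    (dW S) (dW_real S) (dW_ne S) (dW' S) (dW'_real S) (dW'_ne S) S.isoGL (isoGL_hg₀ S) hGR hGR₂ hGR₃ η₃ 1 t φ
  rw [cmPairRep_one_center'] at h
  show lineRep V S hGR hGR₀ hGR₁ hGR₂ hGR₃ η₀ η₁ η₂ η₃ 3
      ((cmFrameEquiv (L : Type) (frameG V) V.Hm (frameD V) (frame_congr V))
          ((1 : ↥(regimeSubgroup L V.Hm)) : ↥(HodgeCM.Adelic.adelicUnitaryGroup (L : Type) V.Hm)), t) φ = _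
  rw [cmFrameEquiv_regime_one]
  exact h

end Collapse

/-! ## §2 The archimedean line datum and the four `ArchLineInput` records -/

section Datum

variable
  (hGR : (cmSplittingDatum (L : Type) finProdFinEquiv (frameD V) (frameD_real V) (frameD_ne V) (dW S) (dW_real S) (dW_ne S)).CompatibleSplitting)
  (hGR₀ : (cmSplittingDatum (L : Type) (e₁) (frameD V) (frameD_real V) (frameD_ne V) (lineVec (L : Type) (dW S 0))
    (fun _ => dW_real S 0) (fun _ => dW_ne S 0)).CompatibleSplitting)
  (hGR₁ : (cmSplittingDatum (L : Type) (e₁) (frameD V) (frameD_real V) (frameD_ne V) (lineVec (L : Type) (dW S 1))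
    (fun _ => dW_real S 1) (fun _ => dW_ne S 1)).CompatibleSplitting)
  (hGR₂ : (cmSplittingDatum (L : Type) (e₁) (frameD V) (frameD_real V) (frameD_ne V) (lineVec (L : Type) (dW' S 0))
    (fun _ => dW'_real S 0) (fun _ => dW'_ne S 0)).CompatibleSplitting)
  (hGR₃ : (cmSplittingDatum (L : Type) (e₁) (frameD V) (frameD_real V) (frameD_ne V) (lineVec (L : Type) (dW' S 1))
    (fun _ => dW'_real S 1) (fun _ => dW'_ne S 1)).CompatibleSplitting)
  (η : CMAdelic (L : Type) (frameD V) × CMAdelic (L : Type) (dW S) →* ℂˣ)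
  (μ : Fin 4 → (InfinitePlace (L : Type) → ℤ))

set_option genInjectivity false in
set_option genSizeOfSpec false in
set_option maxHeartbeats 800000 in
/-- **The archimedean line datum** of the S pin: per line `k : Fin 4` the archimedean test function `Φ_∞,k`, the rational base point
`x₀,k` with `Φ_∞,k(x₀,k) ≠ 0`, the centre eigenvalue `c k`, and the two NAMED hypotheses — over the integer weight vectors `μ k` ((J-μ)), a PARAMETER of the structure (model1 TYPE RULING (A-μ)(i) 22:27:03Z: E's `μ` binder is V-free, `𝔄 V c : ArchLineDatum … (η V c) (μ c)`, so (N1) is `rfl` against E's `μ c k`) —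
(D5-ctr)_k (`hctr₀…₃`) and (J-μ)_k (`hμ₀…₃`) of the module docstring.  No field is a cited fact; the two hypothesis families are the
archimedean inputs binder-2's ArchDatum rows discharge. -/
structure ArchLineDatum where
  /-- the archimedean test functions `Φ_∞,k ∈ 𝓢((L⁺ ⊗ ℝ)³)` -/
  Φinf : Fin 4 → 𝓢(((Fin 3) → mixedSpace (↥(maximalRealSubfield L))), ℂ)
  /-- the rational base points -/
  x₀ : Fin 4 → (Fin 3 → ↥(maximalRealSubfield L))
  /-- `Φ_∞,k(x₀,k) ≠ 0` -/
  hx₀ : ∀ k, Φinf k (SupplyInstance.archEmb (↥(maximalRealSubfield L)) (Fin 3) (x₀ k)) ≠ 0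
  /-- the eigenvalue of the archimedean centre `u_∞ · 1_V` on `φ_N(Φ_∞,k)` -/
  c : Fin 4 → (↥(Literature.NumberTheory.Automorphic.relNormOneInfUnits (↥(maximalRealSubfield L)) L) → ℂ)
  /-- (D5-ctr)₀ -/
  hctr₀ : ∀ (N : ℕ) (t : ↥(Literature.NumberTheory.Automorphic.relNormOneInfUnits (↥(maximalRealSubfield L)) L)),
    cmPairRep (L : Type) e₁ (frameD V) (frameD_real V) (frameD_ne V) (lineVec (L : Type) (dW S 0)) (fun _ => dW_real S 0)
        (fun _ => dW_ne S 0) hGR₀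
        (CMCenter (L : Type) (frameD V)
            ((UnitaryGroup.cmAdelicOneEquivRelNormOne (L : Type)).symm (Literature.NumberTheory.Automorphic.relNormOneInfToIdeles (↥(maximalRealSubfield L)) L t)), 1)
        (SupplyInstance.testFun (↥(maximalRealSubfield L)) (Fin 3) (Φinf 0) (x₀ 0) N) =
      c 0 t • SupplyInstance.testFun (↥(maximalRealSubfield L)) (Fin 3) (Φinf 0) (x₀ 0) N
  /-- (D5-ctr)₁ -/
  hctr₁ : ∀ (N : ℕ) (t : ↥(Literature.NumberTheory.Automorphic.relNormOneInfUnits (↥(maximalRealSubfield L)) L)),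
    cmPairRep (L : Type) e₁ (frameD V) (frameD_real V) (frameD_ne V) (lineVec (L : Type) (dW S 1)) (fun _ => dW_real S 1)
        (fun _ => dW_ne S 1) hGR₁
        (CMCenter (L : Type) (frameD V)
            ((UnitaryGroup.cmAdelicOneEquivRelNormOne (L : Type)).symm (Literature.NumberTheory.Automorphic.relNormOneInfToIdeles (↥(maximalRealSubfield L)) L t)), 1)
        (SupplyInstance.testFun (↥(maximalRealSubfield L)) (Fin 3) (Φinf 1) (x₀ 1) N) =
      c 1 t • SupplyInstance.testFun (↥(maximalRealSubfield L)) (Fin 3) (Φinf 1) (x₀ 1) N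
  /-- (D5-ctr)₂ -/
  hctr₂ : ∀ (N : ℕ) (t : ↥(Literature.NumberTheory.Automorphic.relNormOneInfUnits (↥(maximalRealSubfield L)) L)),
    cmPairRep (L : Type) e₁ (frameD V) (frameD_real V) (frameD_ne V) (lineVec (L : Type) (dW' S 0)) (fun _ => dW'_real S 0)
        (fun _ => dW'_ne S 0) hGR₂
        (CMCenter (L : Type) (frameD V)
            ((UnitaryGroup.cmAdelicOneEquivRelNormOne (L : Type)).symm (Literature.NumberTheory.Automorphic.relNormOneInfToIdeles (↥(maximalRealSubfield L)) L t)), 1)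
        (SupplyInstance.testFun (↥(maximalRealSubfield L)) (Fin 3) (Φinf 2) (x₀ 2) N) =
      c 2 t • SupplyInstance.testFun (↥(maximalRealSubfield L)) (Fin 3) (Φinf 2) (x₀ 2) N
  /-- (D5-ctr)₃ -/
  hctr₃ : ∀ (N : ℕ) (t : ↥(Literature.NumberTheory.Automorphic.relNormOneInfUnits (↥(maximalRealSubfield L)) L)),
    cmPairRep (L : Type) e₁ (frameD V) (frameD_real V) (frameD_ne V) (lineVec (L : Type) (dW' S 1)) (fun _ => dW'_real S 1)
        (fun _ => dW'_ne S 1) hGR₃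
        (CMCenter (L : Type) (frameD V)
            ((UnitaryGroup.cmAdelicOneEquivRelNormOne (L : Type)).symm (Literature.NumberTheory.Automorphic.relNormOneInfToIdeles (↥(maximalRealSubfield L)) L t)), 1)
        (SupplyInstance.testFun (↥(maximalRealSubfield L)) (Fin 3) (Φinf 3) (x₀ 3) N) =
      c 3 t • SupplyInstance.testFun (↥(maximalRealSubfield L)) (Fin 3) (Φinf 3) (x₀ 3) N
  /-- (J-μ)₀ : `η₀(1,u_∞) · χ₀(1, u_∞·1) · c₀(u_∞) = archWeight L (μ 0) u_∞` -/
  hμ₀ : ∀ t : ↥(Literature.NumberTheory.Automorphic.relNormOneInfUnits (↥(maximalRealSubfield L)) L),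
    ((eta₀ V S η (1, (UnitaryGroup.cmAdelicOneEquivRelNormOne (L : Type)).symm (Literature.NumberTheory.Automorphic.relNormOneInfToIdeles (↥(maximalRealSubfield L)) L t)) *
            cmLineChar₀ (L : Type) finProdFinEquiv e₁ (frameD V) (frameD_real V) (frameD_ne V) (dW S) (dW_real S) (dW_ne S)
              hGR hGR₀ hGR₁
              (1, CMCenter (L : Type) (lineVec (L : Type) (dW S 0))
                ((UnitaryGroup.cmAdelicOneEquivRelNormOne (L : Type)).symm (Literature.NumberTheory.Automorphic.relNormOneInfToIdeles (↥(maximalRealSubfield L)) L t))) :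
          ℂˣ) : ℂ) * c 0 t =
      Literature.NumberTheory.Automorphic.archWeight (L : Type) (μ 0) t
  /-- (J-μ)₁ -/
  hμ₁ : ∀ t : ↥(Literature.NumberTheory.Automorphic.relNormOneInfUnits (↥(maximalRealSubfield L)) L),
    ((eta₁ V S η (1, (UnitaryGroup.cmAdelicOneEquivRelNormOne (L : Type)).symm (Literature.NumberTheory.Automorphic.relNormOneInfToIdeles (↥(maximalRealSubfield L)) L t)) *
            cmLineChar₁ (L : Type) finProdFinEquiv e₁ (frameD V) (frameD_real V) (frameD_ne V) (dW S) (dW_real S) (dW_ne S)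
              hGR hGR₀ hGR₁
              (1, CMCenter (L : Type) (lineVec (L : Type) (dW S 1))
                ((UnitaryGroup.cmAdelicOneEquivRelNormOne (L : Type)).symm (Literature.NumberTheory.Automorphic.relNormOneInfToIdeles (↥(maximalRealSubfield L)) L t))) :
          ℂˣ) : ℂ) * c 1 t =
      Literature.NumberTheory.Automorphic.archWeight (L : Type) (μ 1) t
  /-- (J-μ)₂ -/
  hμ₂ : ∀ t : ↥(Literature.NumberTheory.Automorphic.relNormOneInfUnits (↥(maximalRealSubfield L)) L),
    ((eta₂ V S η (1, (UnitaryGroup.cmAdelicOneEquivRelNormOne (L : Type)).symm (Literature.NumberTheory.Automorphic.relNormOneInfToIdeles (↥(maximalRealSubfield L)) L t)) *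
            cmConjLineChar₀ (L : Type) finProdFinEquiv e₁ (frameD V) (frameD_real V) (frameD_ne V) (dW S) (dW_real S) (dW_ne S)
              (dW' S) (dW'_real S) (dW'_ne S) S.isoGL (isoGL_hg₀ S) hGR hGR₂ hGR₃
              (1, CMCenter (L : Type) (lineVec (L : Type) (dW' S 0))
                ((UnitaryGroup.cmAdelicOneEquivRelNormOne (L : Type)).symm (Literature.NumberTheory.Automorphic.relNormOneInfToIdeles (↥(maximalRealSubfield L)) L t))) :
          ℂˣ) : ℂ) * c 2 t =
      Literature.NumberTheory.Automorphic.archWeight (L : Type) (μ 2) t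
  /-- (J-μ)₃ -/
  hμ₃ : ∀ t : ↥(Literature.NumberTheory.Automorphic.relNormOneInfUnits (↥(maximalRealSubfield L)) L),
    ((eta₃ V S η (1, (UnitaryGroup.cmAdelicOneEquivRelNormOne (L : Type)).symm (Literature.NumberTheory.Automorphic.relNormOneInfToIdeles (↥(maximalRealSubfield L)) L t)) *
            cmConjLineChar₁ (L : Type) finProdFinEquiv e₁ (frameD V) (frameD_real V) (frameD_ne V) (dW S) (dW_real S) (dW_ne S)
              (dW' S) (dW'_real S) (dW'_ne S) S.isoGL (isoGL_hg₀ S) hGR hGR₂ hGR₃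
              (1, CMCenter (L : Type) (lineVec (L : Type) (dW' S 1))
                ((UnitaryGroup.cmAdelicOneEquivRelNormOne (L : Type)).symm (Literature.NumberTheory.Automorphic.relNormOneInfToIdeles (↥(maximalRealSubfield L)) L t))) :
          ℂˣ) : ℂ) * c 3 t =
      Literature.NumberTheory.Automorphic.archWeight (L : Type) (μ 3) t

variable {V S hGR hGR₀ hGR₁ hGR₂ hGR₃ η μ}

/-- **(W-wt) = D5 for the four lines, PROVED from (D5-ctr) ∧ (J-μ)**: `lineRepD k (1, t_∞) φ_N(Φ_∞,k) = archWeight L (μ k) t_∞ • φ_N(Φ_∞,k)`. -/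
theorem lineRepD_one_inf_testFun (A : ArchLineDatum V S hGR hGR₀ hGR₁ hGR₂ hGR₃ η μ) (k : Fin 4) (N : ℕ)
    (t : ↥(Literature.NumberTheory.Automorphic.relNormOneInfUnits (↥(maximalRealSubfield L)) L)) :
    lineRepD V S hGR hGR₀ hGR₁ hGR₂ hGR₃ η k (1, Literature.NumberTheory.Automorphic.relNormOneInfToIdeles (↥(maximalRealSubfield L)) L t)
        (SupplyInstance.testFun (↥(maximalRealSubfield L)) (Fin 3) (A.Φinf k) (A.x₀ k) N) =
      Literature.NumberTheory.Automorphic.archWeight (L : Type) (μ k) t • SupplyInstance.testFun (↥(maximalRealSubfield L)) (Fin 3) (A.Φinf k) (A.x₀ k) N := by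
  fin_cases k
  · have h := lineRepOf_zero_one_center V S hGR hGR₀ hGR₁ hGR₂ hGR₃ (eta₀ V S η) (eta₁ V S η) (eta₂ V S η) (eta₃ V S η)
      (Literature.NumberTheory.Automorphic.relNormOneInfToIdeles (↥(maximalRealSubfield L)) L t) (SupplyInstance.testFun (↥(maximalRealSubfield L)) (Fin 3) (A.Φinf 0) (A.x₀ 0) N)
    rw [A.hctr₀ N t, smul_smul, A.hμ₀ t] at h
    exact h
  · have h := lineRepOf_one_one_center V S hGR hGR₀ hGR₁ hGR₂ hGR₃ (eta₀ V S η) (eta₁ V S η) (eta₂ V S η) (eta₃ V S η)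
      (Literature.NumberTheory.Automorphic.relNormOneInfToIdeles (↥(maximalRealSubfield L)) L t) (SupplyInstance.testFun (↥(maximalRealSubfield L)) (Fin 3) (A.Φinf 1) (A.x₀ 1) N)
    rw [A.hctr₁ N t, smul_smul, A.hμ₁ t] at h
    exact h
  · have h := lineRepOf_two_one_center V S hGR hGR₀ hGR₁ hGR₂ hGR₃ (eta₀ V S η) (eta₁ V S η) (eta₂ V S η) (eta₃ V S η)
      (Literature.NumberTheory.Automorphic.relNormOneInfToIdeles (↥(maximalRealSubfield L)) L t) (SupplyInstance.testFun (↥(maximalRealSubfield L)) (Fin 3) (A.Φinf 2) (A.x₀ 2) N)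
    rw [A.hctr₂ N t, smul_smul, A.hμ₂ t] at h
    exact h
  · have h := lineRepOf_three_one_center V S hGR hGR₀ hGR₁ hGR₂ hGR₃ (eta₀ V S η) (eta₁ V S η) (eta₂ V S η) (eta₃ V S η)
      (Literature.NumberTheory.Automorphic.relNormOneInfToIdeles (↥(maximalRealSubfield L)) L t) (SupplyInstance.testFun (↥(maximalRealSubfield L)) (Fin 3) (A.Φinf 3) (A.x₀ 3) N)
    rw [A.hctr₃ N t, smul_smul, A.hμ₃ t] at h
    exact h

/-- **the four `ArchLineInput` records of the S pin** (binder `A` of `archSideOf`), uniformly in `k`, with the weight LITERALLY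
`w := archWeight L (μ k)` ((N1): binder-1's `hAw` is `rfl`, `archLineInputOf_w`). -/
def archLineInputOf (A : ArchLineDatum V S hGR hGR₀ hGR₁ hGR₂ hGR₃ η μ) (k : Fin 4) :
    ArchLineInput V (lineRepD V S hGR hGR₀ hGR₁ hGR₂ hGR₃ η k) where
  Φinf := A.Φinf k
  x₀ := A.x₀ k
  hx₀ := A.hx₀ k
  w := Literature.NumberTheory.Automorphic.archWeight (L : Type) (μ k)
  weight N t := lineRepD_one_inf_testFun A k N t

/-- (Ported verbatim from the HodgeCMPerL package; no docstring in the source.) -/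
@[simp] theorem archLineInputOf_Φinf (A : ArchLineDatum V S hGR hGR₀ hGR₁ hGR₂ hGR₃ η μ) (k : Fin 4) :
    (archLineInputOf A k).Φinf = A.Φinf k := rfl

/-- (Ported verbatim from the HodgeCMPerL package; no docstring in the source.) -/
@[simp] theorem archLineInputOf_x₀ (A : ArchLineDatum V S hGR hGR₀ hGR₁ hGR₂ hGR₃ η μ) (k : Fin 4) :
    (archLineInputOf A k).x₀ = A.x₀ k := rfl

/-- (N1): the weight of line `k` is `archWeight L (μ k)` BY `rfl`. -/
@[simp] theorem archLineInputOf_w (A : ArchLineDatum V S hGR hGR₀ hGR₁ hGR₂ hGR₃ η μ) (k : Fin 4) :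
    (archLineInputOf A k).w = Literature.NumberTheory.Automorphic.archWeight (L : Type) (μ k) := rfl

/-- (Ported verbatim from the HodgeCMPerL package; no docstring in the source.) -/
theorem archLineInputOf_w_apply (A : ArchLineDatum V S hGR hGR₀ hGR₁ hGR₂ hGR₃ η μ) (k : Fin 4)
    (t : ↥(Literature.NumberTheory.Automorphic.relNormOneInfUnits (↥(maximalRealSubfield L)) L)) :
    (archLineInputOf A k).w t = Literature.NumberTheory.Automorphic.archWeight (L : Type) (μ k) t := rfl

end Datum

end ArchSideTerm

end HodgeCM.Model
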